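import Literature.AlgebraicGeometry.ComplexMultiplication.CMTypeCommutantCriterion
import Literature.AlgebraicGeometry.HodgeTheory.CMAbelianVarietyHodgeGroupRealPointsCompactForm
import Literature.AlgebraicGeometry.Milne1999.BicommutantSemisimple
import HarnessLib

/-!
# Milne's commutant criterion for CM (Complex Multiplication, Ch. I Prop. 3.3): junctions of the `End⁰(A)`-form
# (`CMTypeCommutantCriterion`) with the tree's earlier forms — integral pull-backs on `H¹(A(ℂ); ℚ)` and Milne's
# Lefschetz centraliser `C(A) ⊗ ℂ` on `H¹(A(ℂ); ℂ)` — and «`C(A) ⊗ ℂ = C₀(A) ⊗_ℚ ℂ`» on complex cohomology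

Family `hodge`, lane `lit-hodgefound` (Track 2 foundations library; skeleton seat `lit-hodgefound-skel-3`, generation 56,
row **A3-G140** FILE 4), topic `Literature/AlgebraicGeometry/ComplexMultiplication`, namespace
`Literature.AlgebraicGeometry.ComplexMultiplication`.  THEOREMS ONLY (no definition, no instance, no named fact; D-0026
net debt `0`).

## Why this file exists (relation of row A3-G140 to the tree)

FILE 3 `CMTypeCommutantCriterion` proves Milne's Prop. 3.3 (b) ⟺ (c) — `A` is of CM-type iff the commutant of `End⁰(A)`
in `End_Ω(H¹(A) ⊗ Ω)` is commutative, «and equals `C(A) ⊗_ℚ Ω`, where `C(A)` is the centre of `End⁰(A)`» — by MILNE'S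
OWN road (semisimplicity of `End⁰(A)` and the double centraliser theorem, FILE 1
`RingTheory/SimpleModule/CommutantCommutativeCMCriterion`), phrased with the rational representation
`bettiRepOp A : End⁰(A)ᵐᵒᵖ → End_ℚ H¹(A(ℂ); ℚ)` and an arbitrary coefficient field `K ⊇ ℚ` on `K ⊗_ℚ H¹(A(ℂ); ℚ)`.
The tree ALREADY held the equivalence in two other vocabularies, proved by a different road (the Hodge group:
«`L(A) ⊃ Hg(A)`», Deligne I 3.4 / 5.1 and Riemann's theorem):
* on complex cohomology `H¹(A(ℂ); ℂ) = complexBetti A.X 1`, with Milne's (1999) Lefschetz centraliser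
  `Milne1999.centralizerAlgebra A` = the commutant of the pull-backs `φ^* = VanGeemen1994.pullbackOne A φ`, `φ ∈ End A`:
  `HodgeTheory.isOfCMType_iff_centralizerAlgebra_comm` and `HodgeTheory.centralizerAlgebra_le_span_pullbackOne_of_isOfCMType`
  (`HodgeTheory/CMTypeIffCentralizerCommutative`);
* on `H¹(A(ℂ); ℚ)` with the INTEGRAL pull-backs `u^* = (bettiCohomology.map u 1).hom`, `u : A ⟶ A`:
  `HodgeTheory.isOfCMType_of_centralizer_bettiCohomology_comm` (⟸, any sub-family `R ⊆ End A`) and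
  `HodgeTheory.commute_of_forall_commute_bettiMap_of_isOfCMType` (⟹; `HodgeTheory/CMAbelianVarietyHodgeGroupRealPointsCompactForm` §1).
This file makes the three vocabularies meet BY NAME (so that no reader takes them for independent results) and adds what
only the `End⁰(A)`-form gives on complex cohomology: Milne's «equals `C(A) ⊗_ℚ ℂ`» for `Milne1999.centralizerAlgebra`,
i.e. Milne 1999 Rem. 1.10 «the canonical map `C₀(A) ⊗_ℚ Q → C(A)` is an isomorphism» (surjectivity, `Q = ℂ`), which
sharpens the tree's `centralizerAlgebra_le_span_pullbackOne_of_isOfCMType` (`C(A) ⊗ ℂ ⊆ End⁰(A) ⊗ ℂ`) to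
`C(A) ⊗ ℂ = C₀(A) ⊗ ℂ`, `C₀(A) = Z(End⁰(A))`.

## Sources, verbatim

* J. S. Milne, *Complex Multiplication* [MilneCM2006], Ch. I §3 Prop. 3.3 (pp. 27–28, open text `paper:url-8ccc30e4daab`):
  «(b) `End⁰(A)` contains an étale subalgebra of degree `2 dim A` over `ℚ`; (c) for any Weil cohomology `X ⇝ H^*(X)` with
  coefficient field `Ω`, the centralizer of `End⁰(A)` in `End_Ω(H¹(A))` is commutative (and equals `C(A) ⊗_ℚ Ω`, where
  `C(A)` is the centre of `End⁰(A)`)».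
* J. S. Milne, *Lefschetz motives and the Tate conjecture*, Compositio Math. 117 (1999) [Milne1999], §1 Remark 1.10
  (p. 53, held `paper:doi-10-1023-a-1000776613765` p0009 L21–L27): «Let `A` be a simple Abelian variety with many
  endomorphisms, and let `C₀(A)` be the centre of `End⁰(A)`. […] For any Weil cohomology theory `H` with coefficient field
  `Q`, the canonical map `C₀(A) ⊗_ℚ Q → C(A)` is an isomorphism».
* D. Mumford, *Abelian Varieties* (1970) [MumfordAV1970], §19 (p. 174): «`End⁰(X) = End X ⊗ ℚ`» (every element of
  `End⁰(A)` is `M⁻¹ f`, `f ∈ End A`: the tree's `Motives.AbelianVariety.endAlgebra.exists_eq_algebraMap_mul_of`).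
* C. Voisin, *Hodge Theory and Complex Algebraic Geometry I* (2002) [VoisinHodgeI2002], §7.1.1: «`H^k(X, ℚ) ⊗ ℂ = H^k(X, ℂ)`»
  (the tree's `HodgeTheory.ofRatClassBaseChangeEquiv`, natural: `HodgeTheory.complexBetti_map_ofRatClassBaseChangeEquiv`).

## What is proved (`A : AbelianVariety ℂ`; `β = ofRatClassBaseChangeEquiv _ 1 : ℂ ⊗_ℚ H¹(A(ℂ); ℚ) ≃ H¹(A(ℂ); ℂ)`,
## `Ψ = β.conjAlgEquiv ℂ : End_ℂ(ℂ ⊗_ℚ H¹(A(ℂ); ℚ)) ≃ₐ[ℂ] End_ℂ H¹(A(ℂ); ℂ)` conjugation by `β`)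

* §1 (`H¹(A(ℂ); ℚ)`, integral pull-backs) `bettiRepOp_op_of` (`bettiRepOp A (op (1 ⊗ u)) = u^*`),
  `bettiRepOp_op_algebraMap_mul_of` (`(M⁻¹ ⊗ u) ↦ M⁻¹ • u^*`), `exists_bettiRepOp_eq_smul` (Mumford's normal form on `H¹`),
  **`centralizer_range_bettiCohomology_map_eq`** (the commutant of `{u^* | u ∈ End A}` IS the commutant of `End⁰(A)`),
  **`isOfCMType_iff_forall_commute_bettiCohomology_map`** (CM-type ⟺ any two endomorphisms of `H¹(A(ℂ); ℚ)` commuting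
  with every integral `u^*` commute — ASSEMBLED from the tree's two Hodge-group halves named above) and
  **`isOfCMType_iff_centralizer_bettiCohomology_map_comm`** (the same in commutant form, DERIVED from FILE 3: the two
  roads provably state one equivalence).
* §2 (`H¹(A(ℂ); ℂ)`) `conjAlgEquiv_baseChange_bettiCohomology_map` (`Ψ(u^* ⊗ 1) = u^*_ℂ = pullbackOne A u`),
  `unop_endAlgebraRepOp_algebraMap_mul_of`, **`conjAlgEquiv_baseChange_bettiRepOp`** (`Ψ((e^*) ⊗ 1) = e^*_ℂ =
  unop (Milne1999.endAlgebraRepOp A e)` for every `e ∈ End⁰(A)`: the complexified rational representation is the complex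
  representation), **`map_conjAlgEquiv_centralizer_baseChange_eq_centralizerAlgebra`** (`Ψ` carries the commutant of
  `End⁰(A) ⊗ 1` on `ℂ ⊗ H¹(A(ℂ); ℚ)` — FILE 3's object for `K = ℂ` — onto `Milne1999.centralizerAlgebra A`),
  **`centralizerAlgebra_comm_iff_centralizer_baseChange_comm`**, **`centralizerAlgebra_comm_iff_centralizer_comm`**
  (Milne's (c) for `Ω = ℂ` on complex cohomology ⟺ (c) on `ℂ ⊗ H¹(ℚ)` ⟺ (c) for `Ω = ℚ`; pure transport and base
  change, no CM theory), whence the tree's `HodgeTheory.isOfCMType_iff_centralizerAlgebra_comm` is re-obtained by Milne's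
  road (an `example`), and **`centralizerAlgebra_eq_span_center_of_isOfCMType`** — «equals `C(A) ⊗_ℚ ℂ`»: for `A` of
  CM-type, `Milne1999.centralizerAlgebra A` is the `ℂ`-span of `{c^*_ℂ | c ∈ Z(End⁰(A))}`
  (`mem_span_center_of_mem_centralizerAlgebra_of_isOfCMType` elementwise).

## References

* [MilneCM2006] J. S. Milne, *Complex Multiplication* (2006/2020), Ch. I §3 Prop. 3.3 (pp. 27–28).
* [Milne1999] J. S. Milne, *Lefschetz motives and the Tate conjecture*, Compositio Math. 117 (1999) 47–81, §1 p. 52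
  (`C(A)`), Remark 1.10 (p. 53).
* [Milne1999LefschetzClasses] J. S. Milne, *Lefschetz classes on abelian varieties*, Duke Math. J. 96 (1999), §1 p. 642
  (`C(A)`), Remark 1.2 (p. 643).
* [MumfordAV1970] D. Mumford, *Abelian Varieties* (1970), §19 (p. 174) and Cor. 2 of Thm. 1.
* [VoisinHodgeI2002] C. Voisin, *Hodge Theory and Complex Algebraic Geometry I* (2002), §7.1.1.
* [LangeBirkenhake1992] H. Lange, Ch. Birkenhake, *Complex Abelian Varieties* (1992), §1.2 and Prop. 1.2.3 (the
  rational representation and its complexification).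
-/

noncomputable section

open Module CategoryTheory
open scoped TensorProduct

namespace Literature.AlgebraicGeometry.ComplexMultiplication

open Literature.AlgebraicGeometry.Motives Literature.AlgebraicGeometry.HodgeTheory
open Literature.AlgebraicGeometry.Milne1999 (IsOfCMType centralizerAlgebra EndHOneOp endAlgebraRepOp
  endAlgebraRepOp_of)
open Literature.AlgebraicGeometry.VanGeemen1994 (pullbackOne)
open Literature.RingTheory.SimpleModule

/-! ## §0 Algebra: commutants under an algebra isomorphism and under base change -/

section Transport

variable {F : Type*} [CommSemiring F] {B B' : Type*} [Semiring B] [Semiring B'] [Algebra F B] [Algebra F B']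

/-- Commutants correspond under an algebra isomorphism: `e(C(S)) = C(e(S))`. [folklore] -/
private theorem map_centralizer_algEquiv (e : B ≃ₐ[F] B') (S : Set B) :
    (Subalgebra.centralizer F S).map (e : B →ₐ[F] B') = Subalgebra.centralizer F (e '' S) := by
  ext y
  rw [Subalgebra.mem_map, Subalgebra.mem_centralizer_iff]
  constructor
  · rintro ⟨x, hx, rfl⟩ _ ⟨g, hg, rfl⟩
    rw [Subalgebra.mem_centralizer_iff] at hx
    change e g * e x = e x * e g
    rw [← map_mul, ← map_mul, hx g hg]
  · intro hy
    refine ⟨e.symm y, ?_, ?_⟩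
    · rw [Subalgebra.mem_centralizer_iff]
      intro g hg
      apply e.injective
      rw [map_mul, map_mul, e.apply_symm_apply]
      exact hy (e g) ⟨g, hg, rfl⟩
    · change e (e.symm y) = y
      exact e.apply_symm_apply y

/-- A subalgebra is commutative iff its image under an algebra isomorphism is. [folklore] -/
private theorem forall_mul_comm_map_iff (e : B ≃ₐ[F] B') (S : Subalgebra F B) :
    (∀ x ∈ S.map (e : B →ₐ[F] B'), ∀ y ∈ S.map (e : B →ₐ[F] B'), x * y = y * x) ↔
      ∀ x ∈ S, ∀ y ∈ S, x * y = y * x := by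
  constructor
  · intro h x hx y hy
    apply e.injective
    rw [map_mul, map_mul]
    exact h (e x) (Subalgebra.mem_map.2 ⟨x, hx, rfl⟩) (e y) (Subalgebra.mem_map.2 ⟨y, hy, rfl⟩)
  · intro h
    rintro _ ⟨x, hx, rfl⟩ _ ⟨y, hy, rfl⟩
    change e x * e y = e y * e x
    rw [← map_mul, ← map_mul, h x hx y hy]

end Transport

section BaseChange

variable {F : Type*} [Field F] (K : Type*) [Field K] [Algebra F K]
  {V : Type*} [AddCommGroup V] [Module F V] [FiniteDimensional F V]

/-- Two sets of endomorphisms with the same commutant have, after base change to `K ⊇ F`, the same commutant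
(`C_K(T_K) = C_F(T) ⊗ K`, the tree's `Commutant.span_baseChange_centralizer_eq`). [folklore] -/
private theorem centralizer_baseChange_image_congr {T₁ T₂ : Set (Module.End F V)}
    (h : Subalgebra.centralizer F T₁ = Subalgebra.centralizer F T₂) :
    Subalgebra.centralizer K ((fun t : Module.End F V => t.baseChange K) '' T₁) =
      Subalgebra.centralizer K ((fun t : Module.End F V => t.baseChange K) '' T₂) := by
  apply Subalgebra.toSubmodule_injective
  rw [← Commutant.span_baseChange_centralizer_eq, ← Commutant.span_baseChange_centralizer_eq]
  have key : {s : Module.End F V | ∀ t ∈ T₁, s * t = t * s} = {s | ∀ t ∈ T₂, s * t = t * s} := by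
    ext s
    have hs := SetLike.ext_iff.1 h s
    rw [Subalgebra.mem_centralizer_iff, Subalgebra.mem_centralizer_iff] at hs
    simp only [Set.mem_setOf_eq]
    constructor
    · intro h₁ t ht
      exact ((hs.1 fun t' ht' => (h₁ t' ht').symm) t ht).symm
    · intro h₂ t ht
      exact ((hs.2 fun t' ht' => (h₂ t' ht').symm) t ht).symm
  rw [key]

end BaseChange

variable (A : AbelianVariety ℂ)

/-! ## §1 On `H¹(A(ℂ); ℚ)`: the integral pull-backs `u^*`, `u ∈ End A`, versus `End⁰(A)` -/

/-- `bettiRepOp A (op (1 ⊗ u)) = u^*` on `H¹(A(ℂ); ℚ)`. [cite: LangeBirkenhake1992, §1.2 (the rational representation)] -/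
theorem bettiRepOp_op_of (u : A ⟶ A) :
    bettiRepOp A (MulOpposite.op (AbelianVariety.endAlgebra.of A u)) = (bettiCohomology.map u.hom.hom.hom 1).hom := by
  rw [bettiRepOp_apply, MulOpposite.unop_op, bettiRep_of, MulOpposite.unop_op]

/-- `bettiRepOp A (op (q ⊗ u)) = q • u^*` (`q ⊗ u = q · (1 ⊗ u)` in `End⁰(A)`). [cite: LangeBirkenhake1992, §1.2 (p. 10)] -/
theorem bettiRepOp_op_algebraMap_mul_of (q : ℚ) (u : A ⟶ A) :
    bettiRepOp A (MulOpposite.op (algebraMap ℚ A.endAlgebra q * AbelianVariety.endAlgebra.of A u)) =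
      q • (bettiCohomology.map u.hom.hom.hom 1).hom := by
  rw [bettiRepOp_apply, MulOpposite.unop_op, map_mul, AlgHom.commutes, bettiRep_of, Algebra.algebraMap_eq_smul_one,
    smul_mul_assoc, one_mul, MulOpposite.unop_smul, MulOpposite.unop_op]

/-- **Mumford's normal form on `H¹`**: every element of the image of `End⁰(A)ᵐᵒᵖ` in `End_ℚ H¹(A(ℂ); ℚ)` is `M⁻¹ · u^*` with
`u ∈ End A`, `M ≥ 1`. [cite: MumfordAV1970, §19 (p. 174: «`End⁰(X) = End X ⊗ ℚ`»)] -/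
theorem exists_bettiRepOp_eq_smul (a : A.endAlgebraᵐᵒᵖ) :
    ∃ (M : ℕ) (u : A ⟶ A), M ≠ 0 ∧ bettiRepOp A a = (M : ℚ)⁻¹ • (bettiCohomology.map u.hom.hom.hom 1).hom := by
  obtain ⟨M, u, hM, hu⟩ := AbelianVariety.endAlgebra.exists_eq_algebraMap_mul_of (MulOpposite.unop a)
  refine ⟨M, u, hM, ?_⟩
  rw [← MulOpposite.op_unop a, hu, bettiRepOp_op_algebraMap_mul_of]

/-- **The commutant of the integral pull-backs `{u^* | u ∈ End A}` in `End_ℚ H¹(A(ℂ); ℚ)` is the commutant of (the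
image of) `End⁰(A)`** — rational scalars commute with everything. This identifies the object of the tree's
`HodgeTheory.isOfCMType_of_centralizer_bettiCohomology_comm` / `HodgeTheory.commute_of_forall_commute_bettiMap_of_isOfCMType`
with the object of FILE 3's `isOfCMType_iff_centralizer_comm`.
[cite: MumfordAV1970, §19 (p. 174)] [cite: MilneCM2006, Ch. I §3 Prop. 3.3 ((c))] -/
theorem centralizer_range_bettiCohomology_map_eq :
    Subalgebra.centralizer ℚ (Set.range fun u : A ⟶ A => (bettiCohomology.map u.hom.hom.hom 1).hom) =
      Subalgebra.centralizer ℚ (Set.range (bettiRepOp A)) := by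
  apply le_antisymm
  · intro x hx
    rw [Subalgebra.mem_centralizer_iff] at hx ⊢
    rintro _ ⟨a, rfl⟩
    obtain ⟨M, u, -, ha⟩ := exists_bettiRepOp_eq_smul A a
    rw [ha, smul_mul_assoc, mul_smul_comm, hx _ ⟨u, rfl⟩]
  · refine Subalgebra.centralizer_le ℚ _ _ ?_
    rintro _ ⟨u, rfl⟩
    exact ⟨_, bettiRepOp_op_of A u⟩

/-- **Milne Prop. 3.3 (b) ⟺ (c) on `H¹(A(ℂ); ℚ)` with the integral pull-backs**: `A` is of CM-type iff any two
endomorphisms of `H¹(A(ℂ); ℚ)` commuting with every `u^*`, `u ∈ End A`, commute with each other.  ASSEMBLED from the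
tree's two halves (Hodge-group road): ⟹ is `HodgeTheory.commute_of_forall_commute_bettiMap_of_isOfCMType`, ⟸ is
`HodgeTheory.isOfCMType_of_centralizer_bettiCohomology_comm` for the family `R = End A`.
[cite: MilneCM2006, Ch. I §3 Prop. 3.3 ((b) ⟺ (c), pp. 27–28)] [cite: Milne1999, §1 Remark 1.10 (p. 53)] -/
theorem isOfCMType_iff_forall_commute_bettiCohomology_map :
    IsOfCMType A ↔
      ∀ x y : Module.End ℚ (bettiCohomology A.X 1),
        (∀ u : A ⟶ A, (bettiCohomology.map u.hom.hom.hom 1).hom * x = x * (bettiCohomology.map u.hom.hom.hom 1).hom) →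
          (∀ u : A ⟶ A, (bettiCohomology.map u.hom.hom.hom 1).hom * y = y * (bettiCohomology.map u.hom.hom.hom 1).hom) →
            x * y = y * x := by
  constructor
  · intro h x y hx hy
    exact commute_of_forall_commute_bettiMap_of_isOfCMType h hx hy
  · intro h
    exact isOfCMType_of_centralizer_bettiCohomology_comm (Set.univ : Set (A ⟶ A))
      fun x y hx hy => h x y (fun u => hx u (Set.mem_univ u)) (fun u => hy u (Set.mem_univ u))

/-- **The same equivalence in commutant form, DERIVED FROM FILE 3** (Milne's double-centraliser road:
`isOfCMType_iff_centralizer_comm` and `centralizer_range_bettiCohomology_map_eq`): `A` is of CM-type iff the commutant of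
`{u^* | u ∈ End A}` in `End_ℚ H¹(A(ℂ); ℚ)` is commutative.  The two roads state one and the same equivalence.
[cite: MilneCM2006, Ch. I §3 Prop. 3.3 ((b) ⟺ (c), pp. 27–28)] -/
theorem isOfCMType_iff_centralizer_bettiCohomology_map_comm :
    IsOfCMType A ↔
      ∀ x ∈ Subalgebra.centralizer ℚ (Set.range fun u : A ⟶ A => (bettiCohomology.map u.hom.hom.hom 1).hom),
        ∀ y ∈ Subalgebra.centralizer ℚ (Set.range fun u : A ⟶ A => (bettiCohomology.map u.hom.hom.hom 1).hom),
          x * y = y * x := by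
  rw [centralizer_range_bettiCohomology_map_eq, isOfCMType_iff_centralizer_comm]

/-! ## §2 On `H¹(A(ℂ); ℂ)`: FILE 3's commutant on `ℂ ⊗_ℚ H¹(A(ℂ); ℚ)` versus Milne's `C(A) ⊗ ℂ = centralizerAlgebra A` -/

/-- **Naturality of `β : ℂ ⊗_ℚ H¹(A(ℂ); ℚ) ≃ H¹(A(ℂ); ℂ)` in algebra form**: conjugation by `β` carries `u^* ⊗ 1` to the
complex pull-back `u^*_ℂ = pullbackOne A u`. [cite: VoisinHodgeI2002, §7.1.1 (`H^k(X, ℚ) ⊗ ℂ = H^k(X, ℂ)`, functorially)] -/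
theorem conjAlgEquiv_baseChange_bettiCohomology_map (u : A ⟶ A) :
    (ofRatClassBaseChangeEquiv (AbelianVariety.isSmoothProjective_holds (A := A)) 1).conjAlgEquiv ℂ
        (((bettiCohomology.map u.hom.hom.hom 1).hom).baseChange ℂ) = pullbackOne A u := by
  apply LinearMap.ext
  intro v
  obtain ⟨t, rfl⟩ := (ofRatClassBaseChangeEquiv (AbelianVariety.isSmoothProjective_holds (A := A)) 1).surjective v
  simp only [LinearEquiv.conjAlgEquiv_apply, LinearMap.comp_apply, LinearEquiv.coe_coe,
    LinearEquiv.symm_apply_apply]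
  exact (complexBetti_map_ofRatClassBaseChangeEquiv (AbelianVariety.isSmoothProjective_holds (A := A))
    (AbelianVariety.isSmoothProjective_holds (A := A)) u.hom.hom.hom t).symm

/-- `unop (endAlgebraRepOp A (q ⊗ u)) = q • u^*_ℂ` on `H¹(A(ℂ); ℂ)`. [cite: Milne1999LefschetzClasses, §1 p. 642] -/
theorem unop_endAlgebraRepOp_algebraMap_mul_of (q : ℚ) (u : A ⟶ A) :
    MulOpposite.unop (endAlgebraRepOp A (algebraMap ℚ A.endAlgebra q * AbelianVariety.endAlgebra.of A u)) =
      (q : ℂ) • pullbackOne A u := by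
  rw [map_mul, AlgHom.commutes, endAlgebraRepOp_of, MulOpposite.unop_mul, MulOpposite.unop_op]
  have h : algebraMap ℚ (EndHOneOp A) q = algebraMap ℂ (EndHOneOp A) (q : ℂ) := rfl
  rw [h, MulOpposite.algebraMap_apply, MulOpposite.unop_op, Algebra.algebraMap_eq_smul_one, mul_smul_comm, mul_one]

/-- Conjugation by `β` is `ℚ`-homogeneous with `q ↦ (q : ℂ)`. [folklore] -/
private theorem conjAlgEquiv_ratSmul (q : ℚ) (X : Module.End ℂ (ℂ ⊗[ℚ] bettiCohomology A.X 1)) :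
    (ofRatClassBaseChangeEquiv (AbelianVariety.isSmoothProjective_holds (A := A)) 1).conjAlgEquiv ℂ (q • X) =
      (q : ℂ) • (ofRatClassBaseChangeEquiv (AbelianVariety.isSmoothProjective_holds (A := A)) 1).conjAlgEquiv ℂ X := by
  rw [← algebraMap_smul ℂ q X, map_smul, eq_ratCast]

/-- **The complexified rational representation IS the complex representation**: for every `e ∈ End⁰(A)`, conjugation
by `β` carries `(e^*) ⊗ 1 ∈ End_ℂ(ℂ ⊗_ℚ H¹(A(ℂ); ℚ))` to `e^*_ℂ = unop (Milne1999.endAlgebraRepOp A e) ∈ End_ℂ H¹(A(ℂ); ℂ)`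
(Mumford's normal form `e = M⁻¹ (1 ⊗ u)` and naturality of `β`).
[cite: LangeBirkenhake1992, Prop. 1.2.3 (`ρ_r ⊗ 1_ℂ`)] [cite: VoisinHodgeI2002, §7.1.1] -/
theorem conjAlgEquiv_baseChange_bettiRepOp (a : A.endAlgebraᵐᵒᵖ) :
    (ofRatClassBaseChangeEquiv (AbelianVariety.isSmoothProjective_holds (A := A)) 1).conjAlgEquiv ℂ
        ((bettiRepOp A a).baseChange ℂ) = MulOpposite.unop (endAlgebraRepOp A (MulOpposite.unop a)) := by
  obtain ⟨M, u, -, hu⟩ := AbelianVariety.endAlgebra.exists_eq_algebraMap_mul_of (MulOpposite.unop a)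
  rw [← MulOpposite.op_unop a, hu, bettiRepOp_op_algebraMap_mul_of, LinearMap.baseChange_smul, conjAlgEquiv_ratSmul,
    conjAlgEquiv_baseChange_bettiCohomology_map, MulOpposite.unop_op, unop_endAlgebraRepOp_algebraMap_mul_of]

/-- **Conjugation by `β` carries the commutant of `End⁰(A) ⊗ 1` in `End_ℂ(ℂ ⊗_ℚ H¹(A(ℂ); ℚ))` (FILE 3's object for `K = ℂ`)
onto Milne's `C(A) ⊗ ℂ = Milne1999.centralizerAlgebra A`, the commutant of the `φ^*` in `End_ℂ H¹(A(ℂ); ℂ)`.**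
[cite: MilneCM2006, Ch. I §3 Prop. 3.3 ((c), `Ω = ℂ`)] [cite: Milne1999LefschetzClasses, §1 p. 642 (definition of `C(A)`)] -/
theorem map_conjAlgEquiv_centralizer_baseChange_eq_centralizerAlgebra :
    (Subalgebra.centralizer ℂ ((fun t : Module.End ℚ (bettiCohomology A.X 1) => t.baseChange ℂ) ''
        Set.range (bettiRepOp A))).map
      ((ofRatClassBaseChangeEquiv (AbelianVariety.isSmoothProjective_holds (A := A)) 1).conjAlgEquiv ℂ :
        Module.End ℂ (ℂ ⊗[ℚ] bettiCohomology A.X 1) →ₐ[ℂ] Module.End ℂ (complexBetti A.X 1)) =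
      centralizerAlgebra A := by
  haveI : FiniteDimensional ℚ (bettiCohomology A.X 1) := finite_bettiCohomology_one A
  rw [← centralizer_baseChange_image_congr ℂ (centralizer_range_bettiCohomology_map_eq A), map_centralizer_algEquiv,
    centralizerAlgebra]
  congr 1
  ext y
  simp only [Set.mem_image, Set.mem_range, exists_exists_eq_and]
  constructor
  · rintro ⟨u, rfl⟩
    exact ⟨u, (conjAlgEquiv_baseChange_bettiCohomology_map A u).symm⟩
  · rintro ⟨u, rfl⟩
    exact ⟨u, conjAlgEquiv_baseChange_bettiCohomology_map A u⟩

/-- **Milne's (c) for `Ω = ℂ` on complex cohomology ⟺ (c) on `ℂ ⊗_ℚ H¹(A(ℂ); ℚ)`**: `C(A) ⊗ ℂ = centralizerAlgebra A` is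
commutative iff the commutant of `End⁰(A) ⊗ 1` in `End_ℂ(ℂ ⊗_ℚ H¹(A(ℂ); ℚ))` is (pure transport along `β`).
[cite: MilneCM2006, Ch. I §3 Prop. 3.3 ((c), `Ω = ℂ`)] -/
theorem centralizerAlgebra_comm_iff_centralizer_baseChange_comm :
    (∀ x ∈ centralizerAlgebra A, ∀ y ∈ centralizerAlgebra A, x * y = y * x) ↔
      ∀ x ∈ Subalgebra.centralizer ℂ ((fun t : Module.End ℚ (bettiCohomology A.X 1) => t.baseChange ℂ) ''
          Set.range (bettiRepOp A)),
        ∀ y ∈ Subalgebra.centralizer ℂ ((fun t : Module.End ℚ (bettiCohomology A.X 1) => t.baseChange ℂ) ''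
          Set.range (bettiRepOp A)), x * y = y * x := by
  rw [← map_conjAlgEquiv_centralizer_baseChange_eq_centralizerAlgebra]
  exact forall_mul_comm_map_iff _ _

/-- **Milne's (c) for `Ω = ℂ` on complex cohomology ⟺ (c) for `Ω = ℚ`**: `C(A) ⊗ ℂ = centralizerAlgebra A` is commutative
iff the commutant of `End⁰(A)` in `End_ℚ H¹(A(ℂ); ℚ)` is (transport along `β` and base change of commutants, FILE 1's
`Commutant.centralizer_baseChange_comm_iff`; no CM theory enters). [cite: MilneCM2006, Ch. I §3 Prop. 3.3 ((c))] -/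
theorem centralizerAlgebra_comm_iff_centralizer_comm :
    (∀ x ∈ centralizerAlgebra A, ∀ y ∈ centralizerAlgebra A, x * y = y * x) ↔
      ∀ x ∈ Subalgebra.centralizer ℚ (Set.range (bettiRepOp A)),
        ∀ y ∈ Subalgebra.centralizer ℚ (Set.range (bettiRepOp A)), x * y = y * x := by
  haveI : FiniteDimensional ℚ (bettiCohomology A.X 1) := finite_bettiCohomology_one A
  rw [centralizerAlgebra_comm_iff_centralizer_baseChange_comm, ← AlgHom.coe_range,
    Commutant.centralizer_baseChange_comm_iff]

/-- The tree's `HodgeTheory.isOfCMType_iff_centralizerAlgebra_comm` (Hodge-group road) re-obtained by Milne's road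
(FILE 3's `isOfCMType_iff_centralizer_comm` and `centralizerAlgebra_comm_iff_centralizer_comm`); not re-declared. -/
example : IsOfCMType A ↔ ∀ x ∈ centralizerAlgebra A, ∀ y ∈ centralizerAlgebra A, x * y = y * x := by
  rw [centralizerAlgebra_comm_iff_centralizer_comm, isOfCMType_iff_centralizer_comm]

variable {A}

/-- Central elements of `End⁰(A)ᵐᵒᵖ` are the `op c`, `c` central in `End⁰(A)`. [folklore] -/
private theorem mem_center_op_iff (a : A.endAlgebraᵐᵒᵖ) :
    a ∈ Subalgebra.center ℚ A.endAlgebraᵐᵒᵖ ↔ MulOpposite.unop a ∈ Subalgebra.center ℚ A.endAlgebra := by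
  rw [Subalgebra.mem_center_iff, Subalgebra.mem_center_iff]
  constructor
  · intro h b
    apply MulOpposite.op_injective
    rw [MulOpposite.op_mul, MulOpposite.op_mul, MulOpposite.op_unop]
    exact (h (MulOpposite.op b)).symm
  · intro h b
    apply MulOpposite.unop_injective
    rw [MulOpposite.unop_mul, MulOpposite.unop_mul]
    exact (h (MulOpposite.unop b)).symm

/-- **«and equals `C(A) ⊗_ℚ Ω`, where `C(A)` is the centre of `End⁰(A)`» on complex cohomology — Milne 1999 Rem. 1.10
«the canonical map `C₀(A) ⊗_ℚ Q → C(A)` is an isomorphism» (its surjectivity, `Q = ℂ`, for every `A` of CM-type):**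
for `A` of CM-type, Milne's `C(A) ⊗ ℂ = Milne1999.centralizerAlgebra A ⊆ End_ℂ H¹(A(ℂ); ℂ)` is the `ℂ`-span of the
`c^*_ℂ = unop (endAlgebraRepOp A c)`, `c ∈ Z(End⁰(A))`.  (Sharpens the tree's
`HodgeTheory.centralizerAlgebra_le_span_pullbackOne_of_isOfCMType`, `C(A) ⊗ ℂ ⊆ End⁰(A) ⊗ ℂ`; FILE 3's
`IsOfCMType.centralizer_baseChange_eq_span_center ℂ` transported along `β`.)
[cite: MilneCM2006, Ch. I §3 Prop. 3.3 ((c): «and equals `C(A) ⊗_ℚ Ω`»)] [cite: Milne1999, §1 Remark 1.10 (p. 53)] -/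
theorem centralizerAlgebra_eq_span_center_of_isOfCMType (h : IsOfCMType A) :
    Subalgebra.toSubmodule (centralizerAlgebra A) =
      Submodule.span ℂ ((fun c : A.endAlgebra => MulOpposite.unop (endAlgebraRepOp A c)) ''
        (Subalgebra.center ℚ A.endAlgebra : Set A.endAlgebra)) := by
  rw [← map_conjAlgEquiv_centralizer_baseChange_eq_centralizerAlgebra, Subalgebra.map_toSubmodule,
    IsOfCMType.centralizer_baseChange_eq_span_center h ℂ, Submodule.map_span]
  congr 1
  ext y
  constructor
  · rintro ⟨_, ⟨_, ht, rfl⟩, rfl⟩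
    obtain ⟨a, ha, rfl⟩ := Subalgebra.mem_map.1 ht
    refine ⟨MulOpposite.unop a, (mem_center_op_iff a).1 ha, ?_⟩
    change _ = (ofRatClassBaseChangeEquiv (AbelianVariety.isSmoothProjective_holds (A := A)) 1).conjAlgEquiv ℂ
      ((bettiRepOp A a).baseChange ℂ)
    rw [conjAlgEquiv_baseChange_bettiRepOp]
  · rintro ⟨c, hc, rfl⟩
    refine ⟨_, ⟨bettiRepOp A (MulOpposite.op c),
      Subalgebra.mem_map.2 ⟨MulOpposite.op c, (mem_center_op_iff _).2 (by rwa [MulOpposite.unop_op]), rfl⟩, rfl⟩, ?_⟩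
    change (ofRatClassBaseChangeEquiv (AbelianVariety.isSmoothProjective_holds (A := A)) 1).conjAlgEquiv ℂ
      ((bettiRepOp A (MulOpposite.op c)).baseChange ℂ) = _
    rw [conjAlgEquiv_baseChange_bettiRepOp, MulOpposite.unop_op]

/-- Under CM, every element of `C(A) ⊗ ℂ` is `c^*_ℂ`-spanned: membership form of
`centralizerAlgebra_eq_span_center_of_isOfCMType`. [cite: MilneCM2006, Ch. I §3 Prop. 3.3 ((c))] [cite: Milne1999, §1 Remark 1.10 (p. 53)] -/
theorem mem_span_center_of_mem_centralizerAlgebra_of_isOfCMType (h : IsOfCMType A)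
    {T : Module.End ℂ (complexBetti A.X 1)} (hT : T ∈ centralizerAlgebra A) :
    T ∈ Submodule.span ℂ ((fun c : A.endAlgebra => MulOpposite.unop (endAlgebraRepOp A c)) ''
      (Subalgebra.center ℚ A.endAlgebra : Set A.endAlgebra)) := by
  rw [← centralizerAlgebra_eq_span_center_of_isOfCMType h, Subalgebra.mem_toSubmodule]
  exact hT

end Literature.AlgebraicGeometry.ComplexMultiplication

end
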